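import Summits.FinalStateConjecture.FinalStateConjecture.Theorems.PhotonSphereChannelsTameCensorshipExactRegionDomain
import Literature.Geometry.Lorentzian.CauchyDevelopmentComap
import Literature.Geometry.Lorentzian.DataEmbeddingNormalSmooth
import Literature.Geometry.Lorentzian.DataEmbeddingOneJetPointwise
import HarnessLib

/-!
# Crux `TameCensorship` (stmt-FinalStateConjecture-10047), line `crush-the-swallowed-interior`:
# clause (B1) of stub B (`stub_exactKerrBookkeeping`) from ONE maximality fact —
# the exact region is received by any maximal development of the unperturbed sub-datum

Clause (B1) of the registered stub `stub_exactKerrBookkeeping` asserts: for a maximal vacuum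
Cauchy development `𝒟` of a datum `D` on `X` which is exactly the Kerr bent-leaf datum along an
open embedding `φ : Kerr.slice a r₁ → X` with compact complement `K = (range φ)ᶜ`, there are an
open `E' ⊇ E = J⁺(ιX) ∖ J⁺(ιK)` and a map `χ : 𝒟 → Kerr.spacetime M a r₋`, smooth on `E'`, with
`χ^* g_Kerr = g_𝒟` on `E'`. This file proves the GENERAL form of that clause from a single
displayed hypothesis — a vacuum Cauchy development `𝒦` of the pulled-back datum `D.comap φ`
which is MAXIMAL (`VacuumCauchyDevelopment.IsMaximal`: every vacuum development of `D.comap φ`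
embeds into it) together with a smooth isometric immersion `ε` of `𝒦` into some spacetime `𝓣`:

* `exactRegion_of_leafMaximal` — then clause (B1) holds with target `𝓣`, for ANY Cauchy
  development structure on `𝒟` (maximality of `𝒟` and `SubdataDevelopmentsEmbed` are not used):
  `E' := V`, the domain-of-dependence component of `ι(range φ)`
  (`isCauchyHypersurface_dodComponent`, in which `ι(range φ)` is a Cauchy hypersurface, and which
  contains `E`, `exactRegion_subset_dodComponent`); `(V, g|_V, ι ∘ φ)` is the vacuum development
  `𝒟.comapAlongRestrict φ V` of `D.comap φ` (Choquet-Bruhat–Geroch 1969, p. 332: "an open subset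
  `U` … such that `U` is a development"); maximality of `𝒦` gives a smooth isometric open
  embedding `ψ : V → 𝒦` over the data, and `χ := ε ∘ ψ` on `V`.

So (B1) of the stub needs exactly one named fact about explicit Kerr: *the Kerr bent-leaf datum
`(Kerr.slice a r₁, bent height T)` has a maximal vacuum Cauchy development carried, isometrically,
by (an open subset of) `Kerr.spacetime M a r₋`* — the Choquet-Bruhat–Geroch theorem applied to
Kerr (the maximal Cauchy development of the leaf is its domain of dependence inside Kerr,
bounded by the Cauchy horizon `r = r₋` and the null cone of the inner edge `r = r₁`). It is a
universal-receiver property and is not certifiable inside the tree's model theory (it needs local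
geometric uniqueness for the vacuum equations); the present file isolates it.

References: Choquet-Bruhat–Geroch, CMP 14 (1969) 329–335, Thm. 3 and p. 332; Sbierski, Ann. Henri
Poincaré 17 (2016) = arXiv:1309.7591, Def. 2.4–2.5, Thm. 2.6; Hawking–Ellis 1973, §6.5–6.6,
§7.5–7.6; Ringström 2009, Def. 16.5, Thm. 16.6.
-/

noncomputable section

-- The tree namespace `Summit.FinalStateConjecture.FinalStateConjecture.…` (summit = sub-problem)
-- repeats a component by design (D-0022), which the `dupNamespace` linter would flag on every decl.
set_option linter.dupNamespace false

open scoped Manifold ContDiff Topology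
open Set Filter Function TopologicalSpace Topology Bundle
open Literature.Geometry.Lorentzian

namespace Summit.FinalStateConjecture.FinalStateConjecture.Theorems.PhotonSphereChannels.TameCensorshipCrush

universe u

variable {n : ℕ} {X : Type u} [TopologicalSpace X] [ChartedSpace (EuclideanSpace ℝ (Fin n)) X]
  [IsManifold (𝓡 n) ∞ X] [ConnectedSpace X] {D : InitialDataSet (𝓡 n) X}

/-- **Core construction.** For a vacuum Cauchy development `𝒟` of `D` on `X`, a smooth open
embedding `φ : N → X` with injective differentials of a connected nonempty `N` with compact
complement `(range φ)ᶜ`, a MAXIMAL vacuum Cauchy development `𝒦` of `D.comap φ` and a smooth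
isometric immersion `ε : 𝒦 → 𝓣` into a spacetime `𝓣`: the domain-of-dependence component `V` of
`ι(range φ)` (`isCauchyHypersurface_dodComponent`) is open, contains `J⁺(ιX) ∖ J⁺(ι (range φ)ᶜ)`
(`exactRegion_subset_dodComponent`), and `χ := ε ∘ ψ` — `ψ : (V, g|_V, ι ∘ φ) → 𝒦` the embedding
of the sub-data development `𝒟.comapAlongRestrict φ V` given by the maximality of `𝒦` — is smooth
on `V` with `χ^* g_𝓣 = g_𝒟` there; if moreover `ε` preserves the time orientations, so does `χ`
on `V` (`ψ` does, and the timecone lemma `TimeOrientation.isFutureDirected_mfderiv_at`).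
Choquet-Bruhat–Geroch 1969, Thm. 3 and p. 332; Sbierski 2016, Def. 2.4–2.5.
[cite: ChoquetBruhatGeroch1969CMP, Thm. 3 and p. 332; Sbierski2016AHP, Def. 2.4 and Def. 2.5] -/
theorem exactRegionCore_of_leafMaximal (𝒟 : VacuumCauchyDevelopment D) {N : Type u}
    [TopologicalSpace N] [ChartedSpace (EuclideanSpace ℝ (Fin n)) N] [IsManifold (𝓡 n) ∞ N]
    [ConnectedSpace N] [Nonempty N] {φ : N → X} (hφ : ContMDiff (𝓡 n) (𝓡 n) (∞ + 1) φ)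
    (hφ' : ∀ u, Injective (mfderiv (𝓡 n) (𝓡 n) φ u)) (hφo : IsOpenEmbedding φ)
    (hK : IsCompact (range φ)ᶜ) (𝒦 : VacuumCauchyDevelopment (D.comap φ hφ hφ'))
    (h𝒦 : 𝒦.IsMaximal) (𝓣 : Spacetime.{u} (n + 1)) (ε : 𝒦.carrier → 𝓣.carrier)
    (hε : ContMDiff (𝓡 (n + 1)) (𝓡 (n + 1)) ∞ ε)
    (hεi : ∀ p, pullbackBilin (I := 𝓡 (n + 1)) (I' := 𝓡 (n + 1)) ε 𝓣.metric.val p = 𝒦.metric.val p) :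
    ∃ (E' : Set 𝒟.carrier) (χ : 𝒟.carrier → 𝓣.carrier),
      (𝒟.metric.causalFuture 𝒟.timeOrientation (range 𝒟.embed) \
          𝒟.metric.causalFuture 𝒟.timeOrientation (𝒟.embed '' (range φ)ᶜ)) ⊆ E' ∧
      IsOpen E' ∧ ContMDiffOn (𝓡 (n + 1)) (𝓡 (n + 1)) ∞ χ E' ∧
      (∀ p ∈ E', pullbackBilin (I := 𝓡 (n + 1)) (I' := 𝓡 (n + 1)) χ 𝓣.metric.val p =
          𝒟.metric.val p) ∧
      (𝒦.timeOrientation.PreservesTimeOrientation ε 𝓣.timeOrientation →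
        ∀ p ∈ E', 𝓣.timeOrientation.IsFutureDirected
          (mfderiv (𝓡 (n + 1)) (𝓡 (n + 1)) χ p (𝒟.timeOrientation.vectorField p))) := by
  classical
  obtain ⟨u₀⟩ := ‹Nonempty N›
  -- the domain-of-dependence component `V` of `ι(range φ)`
  obtain ⟨hVo, hVc, hιV, hC⟩ := isCauchyHypersurface_dodComponent 𝒟.toCauchyDevelopment hφo u₀
  set V : Opens 𝒟.carrier := ⟨_, hVo⟩ with hV_def
  have hEV : 𝒟.metric.causalFuture 𝒟.timeOrientation (range 𝒟.embed) \
      𝒟.metric.causalFuture 𝒟.timeOrientation (𝒟.embed '' (range φ)ᶜ) ⊆ (V : Set 𝒟.carrier) :=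
    exactRegion_subset_dodComponent 𝒟.toCauchyDevelopment hφo hK u₀
  -- the sub-data development `(V, g|_V, ι ∘ φ)` of `D.comap φ`
  have hν : ∀ u, MDifferentiableAt (𝓡 n) (𝓡 (n + 1)).tangent
      (fun x ↦ (TotalSpace.mk' (EuclideanSpace ℝ (Fin (n + 1))) (𝒟.embed x) (𝒟.normal x) :
        TangentBundle (𝓡 (n + 1)) 𝒟.carrier)) (φ u) := fun u ↦
    𝒟.toDataEmbedding.mdifferentiableAt_embed_normal (φ u)
  have hC' : (𝒟.metric.restrict PseudoRiemannianMetric.contMDiff_restrict_holds V).IsCauchyHypersurface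
      (𝒟.timeOrientation.restrict PseudoRiemannianMetric.contMDiff_restrict_holds
        𝒟.timeOrientation.contMDiff_restrict_holds V)
      (range ((𝒟.toDataEmbedding.comapAlong φ hφ hφ' hφo hν).embedOpens V hιV)) := by
    intro γ s hγ
    obtain ⟨t, ⟨hts, u, hu⟩, huniq⟩ := hC γ s hγ
    refine ⟨t, ⟨hts, u, Subtype.ext hu⟩, fun t' ht' ↦ huniq t' ⟨ht'.1, ?_⟩⟩
    obtain ⟨u', hu'⟩ := ht'.2
    exact ⟨u', congrArg Subtype.val hu'⟩
  set R : VacuumCauchyDevelopment (D.comap φ hφ hφ') :=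
    𝒟.comapAlongRestrict φ hφ hφ' hφo hν V hVc hιV hC' with hR_def
  -- maximality of `𝒦`: the embedding `ψ : V → 𝒦`
  obtain ⟨ψ, hψs, -, hψi, hψτ, -⟩ := h𝒦 R
  -- `χ := ε ∘ ψ` on `V`
  set t₀ : 𝓣.carrier := ε (ψ (R.embed u₀)) with ht₀_def
  set χ : 𝒟.carrier → 𝓣.carrier := fun p ↦
    if h : p ∈ (V : Set 𝒟.carrier) then ε (ψ ⟨p, h⟩) else t₀ with hχ_def
  have hχV : (fun x : V ↦ χ x) = ε ∘ ψ := by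
    funext x
    simp only [hχ_def, Function.comp_apply, Subtype.coe_prop, dif_pos, Subtype.coe_eta]
  have hεψ : ContMDiff (𝓡 (n + 1)) (𝓡 (n + 1)) ∞ (ε ∘ ψ) := hε.comp hψs
  -- smoothness on `V`: `χ ∘ (V ↪ M) = ε ∘ ψ`
  have hχat : ∀ p (hp : p ∈ (V : Set 𝒟.carrier)), ContMDiffAt (𝓡 (n + 1)) (𝓡 (n + 1)) ∞ χ p := by
    intro p hp
    have h : ContMDiffAt (𝓡 (n + 1)) (𝓡 (n + 1)) ∞ (fun x : V ↦ χ x) ⟨p, hp⟩ := by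
      rw [hχV]
      exact hεψ.contMDiffAt
    exact contMDiffAt_subtype_iff.mp h
  -- the differential on `V`: `dχ_p = d(χ ∘ ι)_⟨p, hp⟩ = d(ε ∘ ψ)_⟨p, hp⟩ = dε ∘ dψ`
  have hdχ : ∀ p (hp : p ∈ (V : Set 𝒟.carrier)), mfderiv (𝓡 (n + 1)) (𝓡 (n + 1)) χ p =
      (mfderiv (𝓡 (n + 1)) (𝓡 (n + 1)) ε (ψ ⟨p, hp⟩)).comp
        (mfderiv (𝓡 (n + 1)) (𝓡 (n + 1)) ψ (⟨p, hp⟩ : R.carrier)) := by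
    intro p hp
    have hdiff : MDifferentiableAt (𝓡 (n + 1)) (𝓡 (n + 1)) χ p :=
      (hχat p hp).mdifferentiableAt (by simp)
    have hd1 : mfderiv (𝓡 (n + 1)) (𝓡 (n + 1)) χ p =
        mfderiv (𝓡 (n + 1)) (𝓡 (n + 1)) (χ ∘ Subtype.val : V → 𝓣.carrier) ⟨p, hp⟩ :=
      (mfderiv_comp_subtypeVal (W := V) (y := ⟨p, hp⟩) hdiff).symm
    have hd2 : mfderiv (𝓡 (n + 1)) (𝓡 (n + 1)) (χ ∘ Subtype.val : V → 𝓣.carrier) ⟨p, hp⟩ =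
        mfderiv (𝓡 (n + 1)) (𝓡 (n + 1)) (ε ∘ ψ) (⟨p, hp⟩ : R.carrier) := by
      rw [show (χ ∘ Subtype.val : V → 𝓣.carrier) = ε ∘ ψ from hχV]
      rfl
    have hd3 : mfderiv (𝓡 (n + 1)) (𝓡 (n + 1)) (ε ∘ ψ) (⟨p, hp⟩ : R.carrier) =
        (mfderiv (𝓡 (n + 1)) (𝓡 (n + 1)) ε (ψ ⟨p, hp⟩)).comp
          (mfderiv (𝓡 (n + 1)) (𝓡 (n + 1)) ψ (⟨p, hp⟩ : R.carrier)) :=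
      mfderiv_comp _ (hε.mdifferentiableAt (by simp)) (hψs.mdifferentiableAt (by simp))
    exact hd1.trans (hd2.trans hd3)
  have hχp : ∀ p (hp : p ∈ (V : Set 𝒟.carrier)), χ p = ε (ψ ⟨p, hp⟩) := fun p hp ↦ by
    simp only [hχ_def, dif_pos hp]
  refine ⟨V, χ, hEV, V.isOpen, fun p hp ↦ (hχat p hp).contMDiffWithinAt, fun p hp ↦ ?_,
    fun hετ p hp ↦ ?_⟩
  · -- the pullback on `V`: `χ^* g_𝓣 = ψ^* (ε^* g_𝓣) = ψ^* g_𝒦 = g|_V`, read on vectors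
    have hψp := hψi.2 (⟨p, hp⟩ : R.carrier)
    have hεp := hεi (ψ ⟨p, hp⟩)
    ext v w
    have e1 : pullbackBilin (I := 𝓡 (n + 1)) (I' := 𝓡 (n + 1)) χ 𝓣.metric.val p v w =
        𝓣.metric.val (ε (ψ ⟨p, hp⟩))
          (mfderiv (𝓡 (n + 1)) (𝓡 (n + 1)) ε (ψ ⟨p, hp⟩)
            (mfderiv (𝓡 (n + 1)) (𝓡 (n + 1)) ψ (⟨p, hp⟩ : R.carrier) v))
          (mfderiv (𝓡 (n + 1)) (𝓡 (n + 1)) ε (ψ ⟨p, hp⟩)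
            (mfderiv (𝓡 (n + 1)) (𝓡 (n + 1)) ψ (⟨p, hp⟩ : R.carrier) w)) := by
      rw [pullbackBilin_apply, hχp p hp, hdχ p hp]
      rfl
    have e2 : 𝓣.metric.val (ε (ψ ⟨p, hp⟩))
          (mfderiv (𝓡 (n + 1)) (𝓡 (n + 1)) ε (ψ ⟨p, hp⟩)
            (mfderiv (𝓡 (n + 1)) (𝓡 (n + 1)) ψ (⟨p, hp⟩ : R.carrier) v))
          (mfderiv (𝓡 (n + 1)) (𝓡 (n + 1)) ε (ψ ⟨p, hp⟩)
            (mfderiv (𝓡 (n + 1)) (𝓡 (n + 1)) ψ (⟨p, hp⟩ : R.carrier) w)) =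
        𝒦.metric.val (ψ ⟨p, hp⟩) (mfderiv (𝓡 (n + 1)) (𝓡 (n + 1)) ψ (⟨p, hp⟩ : R.carrier) v)
          (mfderiv (𝓡 (n + 1)) (𝓡 (n + 1)) ψ (⟨p, hp⟩ : R.carrier) w) := by
      have := congrArg (fun B ↦ B (mfderiv (𝓡 (n + 1)) (𝓡 (n + 1)) ψ (⟨p, hp⟩ : R.carrier) v)
        (mfderiv (𝓡 (n + 1)) (𝓡 (n + 1)) ψ (⟨p, hp⟩ : R.carrier) w)) hεp
      simpa only [pullbackBilin_apply] using this
    have e3 : 𝒦.metric.val (ψ ⟨p, hp⟩) (mfderiv (𝓡 (n + 1)) (𝓡 (n + 1)) ψ (⟨p, hp⟩ : R.carrier) v)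
          (mfderiv (𝓡 (n + 1)) (𝓡 (n + 1)) ψ (⟨p, hp⟩ : R.carrier) w) =
        R.metric.val (⟨p, hp⟩ : R.carrier) v w := by
      have := congrArg (fun B ↦ B v w) hψp
      simpa only [pullbackBilin_apply] using this
    rw [e1, e2, e3]
    rfl
  · -- the time orientation on `V`: `dχ T = dε (dψ T)`, `dψ T` future (ψ preserves), `dε` of a
    -- future vector future (pointwise timecone lemma at `ψ ⟨p, hp⟩`)
    have h1 : 𝒦.timeOrientation.IsFutureDirected
        (mfderiv (𝓡 (n + 1)) (𝓡 (n + 1)) ψ (⟨p, hp⟩ : R.carrier)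
          (R.timeOrientation.vectorField (⟨p, hp⟩ : R.carrier))) := hψτ ⟨p, hp⟩
    have h2 := TimeOrientation.isFutureDirected_mfderiv_at (τ := 𝓣.timeOrientation)
      (τN := 𝒦.timeOrientation) (hετ (ψ ⟨p, hp⟩)) (hεi (ψ ⟨p, hp⟩)) h1
    rw [hdχ p hp, hχp p hp]
    exact h2

/-- **Clause (B1) of stub B from leaf-maximality** (registered shape). Let `𝒟` be a vacuum Cauchy
development of `D` on `X`, `φ : N → X` a smooth open embedding with injective differentials of a
connected nonempty `N` with compact complement `(range φ)ᶜ`, and suppose the pulled-back datum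
`D.comap φ` has a MAXIMAL vacuum Cauchy development `𝒦` with a smooth isometric immersion
`ε : 𝒦 → 𝓣` into a spacetime `𝓣`. Then there are an open `E' ⊇ J⁺(ιX) ∖ J⁺(ι (range φ)ᶜ)` and
`χ : 𝒟 → 𝓣`, smooth on `E'`, with `χ^* g_𝓣 = g_𝒟` on `E'` (`exactRegionCore_of_leafMaximal`).
Choquet-Bruhat–Geroch 1969, Thm. 3 and p. 332; Sbierski 2016, Def. 2.4–2.5.
[cite: ChoquetBruhatGeroch1969CMP, Thm. 3 and p. 332; Sbierski2016AHP, Def. 2.4 and Def. 2.5] -/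
theorem exactRegion_of_leafMaximal (𝒟 : VacuumCauchyDevelopment D) {N : Type u}
    [TopologicalSpace N] [ChartedSpace (EuclideanSpace ℝ (Fin n)) N] [IsManifold (𝓡 n) ∞ N]
    [ConnectedSpace N] [Nonempty N] {φ : N → X} (hφ : ContMDiff (𝓡 n) (𝓡 n) (∞ + 1) φ)
    (hφ' : ∀ u, Injective (mfderiv (𝓡 n) (𝓡 n) φ u)) (hφo : IsOpenEmbedding φ)
    (hK : IsCompact (range φ)ᶜ) (𝒦 : VacuumCauchyDevelopment (D.comap φ hφ hφ'))
    (h𝒦 : 𝒦.IsMaximal) (𝓣 : Spacetime.{u} (n + 1)) (ε : 𝒦.carrier → 𝓣.carrier)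
    (hε : ContMDiff (𝓡 (n + 1)) (𝓡 (n + 1)) ∞ ε)
    (hεi : ∀ p, pullbackBilin (I := 𝓡 (n + 1)) (I' := 𝓡 (n + 1)) ε 𝓣.metric.val p = 𝒦.metric.val p) :
    ∃ (E' : Set 𝒟.carrier) (χ : 𝒟.carrier → 𝓣.carrier),
      (𝒟.metric.causalFuture 𝒟.timeOrientation (range 𝒟.embed) \
          𝒟.metric.causalFuture 𝒟.timeOrientation (𝒟.embed '' (range φ)ᶜ)) ⊆ E' ∧
      (IsOpen E' ∧ ContMDiffOn (𝓡 (n + 1)) (𝓡 (n + 1)) ∞ χ E' ∧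
        ∀ p ∈ E', pullbackBilin (I := 𝓡 (n + 1)) (I' := 𝓡 (n + 1)) χ 𝓣.metric.val p =
          𝒟.metric.val p) := by
  obtain ⟨E', χ, hE, hEo, hχs, hχi, -⟩ :=
    exactRegionCore_of_leafMaximal 𝒟 hφ hφ' hφo hK 𝒦 h𝒦 𝓣 ε hε hεi
  exact ⟨E', χ, hE, hEo, hχs, hχi⟩

/-- **Oriented form** (what clauses (B3)/(B4) consume): if moreover `ε` preserves the time
orientations, the chart `χ` of `exactRegion_of_leafMaximal` can be taken time-orientation
preserving on `E'` (`dχ` sends the orienting field of `𝒟` into the future cone of `𝓣`).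
[cite: ChoquetBruhatGeroch1969CMP, Thm. 3 and p. 332; ONeillSemiRiemannian1983, Ch. 5, p. 145] -/
theorem exactRegion_of_leafMaximal_oriented (𝒟 : VacuumCauchyDevelopment D) {N : Type u}
    [TopologicalSpace N] [ChartedSpace (EuclideanSpace ℝ (Fin n)) N] [IsManifold (𝓡 n) ∞ N]
    [ConnectedSpace N] [Nonempty N] {φ : N → X} (hφ : ContMDiff (𝓡 n) (𝓡 n) (∞ + 1) φ)
    (hφ' : ∀ u, Injective (mfderiv (𝓡 n) (𝓡 n) φ u)) (hφo : IsOpenEmbedding φ)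
    (hK : IsCompact (range φ)ᶜ) (𝒦 : VacuumCauchyDevelopment (D.comap φ hφ hφ'))
    (h𝒦 : 𝒦.IsMaximal) (𝓣 : Spacetime.{u} (n + 1)) (ε : 𝒦.carrier → 𝓣.carrier)
    (hε : ContMDiff (𝓡 (n + 1)) (𝓡 (n + 1)) ∞ ε)
    (hεi : ∀ p, pullbackBilin (I := 𝓡 (n + 1)) (I' := 𝓡 (n + 1)) ε 𝓣.metric.val p = 𝒦.metric.val p)
    (hετ : 𝒦.timeOrientation.PreservesTimeOrientation ε 𝓣.timeOrientation) :
    ∃ (E' : Set 𝒟.carrier) (χ : 𝒟.carrier → 𝓣.carrier),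
      (𝒟.metric.causalFuture 𝒟.timeOrientation (range 𝒟.embed) \
          𝒟.metric.causalFuture 𝒟.timeOrientation (𝒟.embed '' (range φ)ᶜ)) ⊆ E' ∧
      IsOpen E' ∧ ContMDiffOn (𝓡 (n + 1)) (𝓡 (n + 1)) ∞ χ E' ∧
      (∀ p ∈ E', pullbackBilin (I := 𝓡 (n + 1)) (I' := 𝓡 (n + 1)) χ 𝓣.metric.val p =
          𝒟.metric.val p) ∧
      (∀ p ∈ E', 𝓣.timeOrientation.IsFutureDirected
          (mfderiv (𝓡 (n + 1)) (𝓡 (n + 1)) χ p (𝒟.timeOrientation.vectorField p))) := by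
  obtain ⟨E', χ, hE, hEo, hχs, hχi, hχτ⟩ :=
    exactRegionCore_of_leafMaximal 𝒟 hφ hφ' hφo hK 𝒦 h𝒦 𝓣 ε hε hεi
  exact ⟨E', χ, hE, hEo, hχs, hχi, hχτ hετ⟩

end Summit.FinalStateConjecture.FinalStateConjecture.Theorems.PhotonSphereChannels.TameCensorshipCrush

end
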